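import Summits.HodgeConjecture.HodgeConjecture.Theorems.NikulinTwinTransportSquareHodgeOfSqrtTwoRationalCore

/-!
# Route NikulinTwinTransport · `SquareGlue` (stmt-HodgeConjecture-13682) — Künneth bookkeeping III:
# the Hodge endomorphisms of `H²` of a K3 surface with `End_Hdg(T) = ℚ + ℚe`, over the marking

Helper file for the glue item `SquareGlue`. The heart of the bookkeeping "Hodge classes in
`H² ⊗ H²` are products of divisors plus `ℚ·id_T + ℚ·e`" (Varesco 2023 p. 8; Huybrechts, *Lectures
on K3 Surfaces*, Ch. 3 §3) is linear algebra over `ℚ`, done here on the rational K3 lattice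
`Λ_ℚ = ℚ²²` with its form `B = k3FormRat` (through a marking `η : H²(S(ℂ); ℂ) ≅ Λ_ℂ` the rational
classes are `Λ_ℚ`, `NS(S)_ℚ` is a subspace `N`, the period is a vector `x ∈ Λ_ℂ` and the Hodge
types on `H²` are read off `x` and `x̄`: `(2,0) = ℂx`, `(0,2) = ℂx̄`, `(1,1) = {x, x̄}^⊥`).

`exists_rankOne_decomposition`: let `N ≤ Λ_ℚ` be the set of rational vectors orthogonal (over `ℂ`)
to `x` and `x̄` (this packages `NS ⊆ H^{1,1}` and Lefschetz `(1,1)`), `ε` a `ℚ`-linear map killing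
`N` with `ε² = 2` on `T = N^⊥` (real multiplication), and `φ` a `ℚ`-linear map whose
complexification `M` preserves the three Hodge types. Assume the UNIQUENESS clause of the route's
sector `SquareHodgeOfSqrtTwo`, read over `Λ_ℚ`: every such `f` killing `N` with values in `T` is
`a + bε` on `T`. Then `φ = Σᵢ B(·, aᵢ) bᵢ + r + s ε` with `aᵢ, bᵢ ∈ N`, `r, s ∈ ℚ` — i.e. `φ` is a
combination of "products of divisors", the identity and `ε`. Steps (all PROVED, Mathlib only):
`N ∩ T = 0` (forced by `ε`: on `N ∩ T`, `0 = ε(εu) = 2u`), so `Λ_ℚ = N ⊕ T`; `φ(N) ⊆ N` (types);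
(the casting lemmas `ratCastΛ_sub`, `k3Form_sub_left`, `eq_of_forall_ratCast` are those of the
parallel file `…SquareHodgeOfSqrtTwoRationalCore` of item 13680, whose `ratEnd_normalForm` is a
variant of the decomposition below with the uniqueness clause phrased on `x₀` alone);
`φ(T) ⊆ T` (the Riesz vector `w` of `u ↦ B(φu, n)` is rational and of type `(1,1)`, hence in `N`:
this is "`Hom_Hdg(T, NS) = 0`" without the irreducibility of `T`); the uniqueness clause applied
to `φ ∘ pr_T`; and `exists_eq_sum_rankOne` for the part supported on `N`.

No new definitions, no named facts. Prover seat prover-pitem-stmt-HodgeConjecture-13682-0.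
-/

namespace Summit.HodgeConjecture.HodgeConjecture.Theorems.NikulinTwinTransport

open Module
open Literature.AlgebraicGeometry.Surfaces

/-! ### `Λ_ℚ ⊂ Λ_ℂ`: complexification -/

/-- **Complexification of a `ℚ`-linear endomorphism of `Λ_ℚ`**: there is a (unique) `ℂ`-linear
endomorphism of `Λ_ℂ` restricting to it on `Λ_ℚ` (its matrix, read in `ℂ`). [folklore] -/
theorem exists_complexification (f : (K3Index → ℚ) →ₗ[ℚ] (K3Index → ℚ)) :
    ∃ M : Module.End ℂ (K3Index → ℂ), ∀ u : K3Index → ℚ, M (fun i => (u i : ℂ)) = fun i => (f u i : ℂ) := by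
  refine ⟨Matrix.toLin' ((LinearMap.toMatrix' f).map (Rat.castHom ℂ)), fun u => ?_⟩
  funext i
  rw [Matrix.toLin'_apply]
  have h := (RingHom.map_mulVec (Rat.castHom ℂ) (LinearMap.toMatrix' f) u i).symm
  rw [LinearMap.toMatrix'_mulVec] at h
  exact h

/-! ### The decomposition -/

/-- **Hodge endomorphisms of `H²` of a K3 surface with `End_Hdg(T) ⊆ ℚ + ℚe` are products of
divisors plus `ℚ·id + ℚ·e`, over the marking.** Data on `Λ_ℚ = ℚ²²` with `B = k3FormRat`: vectors
`x, x̄ ∈ Λ_ℂ` (the period and its conjugate); `N ≤ Λ_ℚ` with `u ∈ N ↔ (u.x) = 0 ∧ (u.x̄) = 0`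
(`N = NS_ℚ`: `NS ⊆ H^{1,1}` and Lefschetz `(1,1)`); `ε` killing `N` with `ε(εt) = 2t` on `T = N^⊥`;
`φ` with a complexification `M` (`M|_{Λ_ℚ} = φ`) fixing the lines `ℂx`, `ℂx̄` and the space
`{x, x̄}^⊥` (a rational endomorphism preserving the Hodge types); and the uniqueness clause: every
`f` with such a complexification, killing `N` and with values in `T`, equals `a + bε` on `T` for
some `a, b ∈ ℚ`. Conclusion: `φ u = Σᵢ B(u, aᵢ) bᵢ + r u + s εu` with `aᵢ, bᵢ ∈ N`, `r, s ∈ ℚ`.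
[cite: Varesco2023, §2 (p. 8)] [cite: Huybrechts2016K3, Ch. 3 §3.2 and Lemma 3.3.1] -/
theorem exists_rankOne_decomposition (x xbar : K3Index → ℂ) (N : Submodule ℚ (K3Index → ℚ))
    (hN : ∀ u : K3Index → ℚ, u ∈ N ↔
      (k3Form (fun i => (u i : ℂ)) x = 0 ∧ k3Form (fun i => (u i : ℂ)) xbar = 0))
    (ε : (K3Index → ℚ) →ₗ[ℚ] (K3Index → ℚ)) (hεN : ∀ n ∈ N, ε n = 0)
    (hεT : ∀ t ∈ k3FormRat.orthogonal N, ε (ε t) = (2 : ℚ) • t)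
    (φ : (K3Index → ℚ) →ₗ[ℚ] (K3Index → ℚ)) (M : Module.End ℂ (K3Index → ℂ))
    (hM : ∀ u : K3Index → ℚ, M (fun i => (u i : ℂ)) = fun i => (φ u i : ℂ))
    (hMx : ∃ c : ℂ, M x = c • x) (hMxbar : ∃ c : ℂ, M xbar = c • xbar)
    (hM11 : ∀ v : K3Index → ℂ, k3Form v x = 0 → k3Form v xbar = 0 →
      k3Form (M v) x = 0 ∧ k3Form (M v) xbar = 0)
    (hU : ∀ (f : (K3Index → ℚ) →ₗ[ℚ] (K3Index → ℚ)) (Mf : Module.End ℂ (K3Index → ℂ)),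
      (∀ u : K3Index → ℚ, Mf (fun i => (u i : ℂ)) = fun i => (f u i : ℂ)) →
      (∃ c : ℂ, Mf x = c • x) → (∃ c : ℂ, Mf xbar = c • xbar) →
      (∀ v : K3Index → ℂ, k3Form v x = 0 → k3Form v xbar = 0 →
        k3Form (Mf v) x = 0 ∧ k3Form (Mf v) xbar = 0) →
      (∀ n ∈ N, f n = 0) → (∀ u, f u ∈ k3FormRat.orthogonal N) →
      ∃ a b : ℚ, ∀ t ∈ k3FormRat.orthogonal N, f t = a • t + b • ε t) :
    ∃ (m : ℕ) (a b : Fin m → K3Index → ℚ) (r s : ℚ), (∀ i, a i ∈ N) ∧ (∀ i, b i ∈ N) ∧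
      ∀ u, φ u = ∑ i, k3FormRat u (a i) • b i + r • u + s • ε u := by
  classical
  set B : LinearMap.BilinForm ℚ (K3Index → ℚ) := k3FormRat with hBdef
  have hBs : B.IsSymm := k3FormRat_isSymm
  have hBr : B.IsRefl := hBs.isRefl
  have hBn : B.Nondegenerate := k3FormRat_nondegenerate
  set T := B.orthogonal N with hTdef
  -- rational vectors of `N` are orthogonal (over `ℂ`) to `x` and `x̄`
  have hNx : ∀ n ∈ N, k3Form (fun i => (n i : ℂ)) x = 0 := fun n hn => ((hN n).1 hn).1
  have hNxbar : ∀ n ∈ N, k3Form (fun i => (n i : ℂ)) xbar = 0 := fun n hn => ((hN n).1 hn).2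
  -- (0) `N ∩ T = 0`, forced by `ε`
  have hdisj : Disjoint N T := by
    rw [Submodule.disjoint_def]
    intro u huN huT
    have h2 : (2 : ℚ) • u = 0 := by rw [← hεT u huT, hεN u huN, map_zero]
    exact (smul_eq_zero.1 h2).resolve_left two_ne_zero
  have hc : IsCompl N T := (LinearMap.BilinForm.isCompl_orthogonal_iff_disjoint hBr).2 hdisj
  -- the projections `P = pr_N`, `Q = pr_T = 1 - P`
  set P := N.projection T hc with hPdef
  have hPN : ∀ u, P u ∈ N := fun u => Submodule.projection_apply_mem hc u
  have hPleft : ∀ n ∈ N, P n = n := fun n hn => Submodule.projection_apply_of_mem_left hc hn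
  have hPright : ∀ t ∈ T, P t = 0 := fun t ht => Submodule.projection_apply_of_mem_right hc ht
  have hQT : ∀ u, u - P u ∈ T := fun u => by
    rw [← Submodule.projection_eq_self_sub_projection hc]
    exact Submodule.projection_apply_mem hc.symm u
  -- (1) `φ(N) ⊆ N`
  have hφN : ∀ n ∈ N, φ n ∈ N := by
    intro n hn
    rw [hN]
    have h := hM11 _ (hNx n hn) (hNxbar n hn)
    rwa [hM] at h
  -- (2) `φ(T) ⊆ T`: the Riesz vector of `u ↦ B(φ u, n)` lies in `N`
  have hφT : ∀ t ∈ T, φ t ∈ T := by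
    intro t ht
    rw [hTdef, LinearMap.BilinForm.mem_orthogonal_iff]
    intro n hn
    -- `w` with `B(φ u, n) = B(u, w)`
    let lam : Module.Dual ℚ (K3Index → ℚ) := (B n) ∘ₗ φ
    set w := (B.toDual hBn).symm lam with hwdef
    have hw : ∀ u, B (φ u) n = B u w := fun u => by
      rw [hBs.eq (φ u) n, hwdef, hBs.eq u, LinearMap.BilinForm.apply_toDual_symm_apply]
      rfl
    -- complexify: `(M z . n) = (z . w)` for all `z ∈ Λ_ℂ`
    have hwC : ∀ z : K3Index → ℂ, k3Form (M z) (fun i => (n i : ℂ)) = k3Form z (fun i => (w i : ℂ)) := by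
      intro z
      have hlin : (k3FormC.flip (fun i => (n i : ℂ))) ∘ₗ M = k3FormC.flip (fun i => (w i : ℂ)) := by
        refine eq_of_forall_ratCast fun u => ?_
        rw [LinearMap.comp_apply, hM, LinearMap.BilinForm.flip_apply, LinearMap.BilinForm.flip_apply,
          k3FormC_apply, k3FormC_apply, k3Form_ratCast, k3Form_ratCast, ← hBdef]
        exact congrArg _ (hw u)
      have h := LinearMap.congr_fun hlin z
      simpa only [LinearMap.comp_apply, LinearMap.BilinForm.flip_apply, k3FormC_apply] using h
    -- `w` is of type `(1,1)`, hence in `N`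
    have hwN : w ∈ N := by
      rw [hN]
      obtain ⟨c, hcx⟩ := hMx
      obtain ⟨c', hcx'⟩ := hMxbar
      constructor
      · rw [k3Form_comm, ← hwC x, hcx, k3Form_smul_left, k3Form_comm, hNx n hn, mul_zero]
      · rw [k3Form_comm, ← hwC xbar, hcx', k3Form_smul_left, k3Form_comm, hNxbar n hn, mul_zero]
    -- so `B(n, φ t) = B(φ t, n) = B(t, w) = 0`
    change B n (φ t) = 0
    rw [hBs.eq n (φ t), hw t, hBs.eq t w]
    exact (LinearMap.BilinForm.mem_orthogonal_iff.1 ht) w hwN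
  -- (3) the uniqueness clause applied to `f = φ ∘ pr_T`
  obtain ⟨mP, aP, dP, haP, hdP, hPsum⟩ := exists_eq_sum_rankOne hBs hBn N P hPN hPright
  let f : (K3Index → ℚ) →ₗ[ℚ] (K3Index → ℚ) := φ ∘ₗ (LinearMap.id - P)
  have hf : ∀ u, f u = φ (u - P u) := fun u => rfl
  -- complexification of `pr_N` as a sum of rank-one maps, and of `f`
  let PC : Module.End ℂ (K3Index → ℂ) :=
    ∑ i, (k3FormC.flip (fun j => (aP i j : ℂ))).smulRight (fun j => (dP i j : ℂ))
  have hPC : ∀ z, PC z = ∑ i, k3Form z (fun j => (aP i j : ℂ)) • fun j => (dP i j : ℂ) := fun z => by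
    simp only [PC, LinearMap.sum_apply, LinearMap.smulRight_apply, LinearMap.BilinForm.flip_apply,
      k3FormC_apply]
  have hPCrat : ∀ u : K3Index → ℚ, PC (fun i => (u i : ℂ)) = fun i => (P u i : ℂ) := fun u => by
    rw [hPC, hPsum u, ratCastΛ_sum]
    refine Finset.sum_congr rfl fun i _ => ?_
    rw [k3Form_ratCast, ratCastΛ_smul]
  let Mf : Module.End ℂ (K3Index → ℂ) := M ∘ₗ (LinearMap.id - PC)
  have hMf : ∀ z, Mf z = M (z - PC z) := fun z => rfl
  have hMfrat : ∀ u : K3Index → ℚ, Mf (fun i => (u i : ℂ)) = fun i => (f u i : ℂ) := fun u => by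
    rw [hMf, hPCrat, ← ratCastΛ_sub, hM, hf]
  -- `PC` kills `x`, `x̄` and maps `{x, x̄}^⊥` into itself
  have hPCx : PC x = 0 := by
    rw [hPC]
    refine Finset.sum_eq_zero fun i _ => ?_
    rw [k3Form_comm, hNx _ (haP i), zero_smul]
  have hPCxbar : PC xbar = 0 := by
    rw [hPC]
    refine Finset.sum_eq_zero fun i _ => ?_
    rw [k3Form_comm, hNxbar _ (haP i), zero_smul]
  have hPC11 : ∀ v, k3Form (PC v) x = 0 ∧ k3Form (PC v) xbar = 0 := fun v => by
    rw [hPC]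
    constructor
    · rw [show k3Form (∑ i, k3Form v (fun j => (aP i j : ℂ)) • fun j => (dP i j : ℂ)) x =
          k3FormC (∑ i, k3Form v (fun j => (aP i j : ℂ)) • fun j => (dP i j : ℂ)) x from
          (k3FormC_apply _ _).symm, map_sum, LinearMap.sum_apply]
      refine Finset.sum_eq_zero fun i _ => ?_
      rw [map_smul, LinearMap.smul_apply, k3FormC_apply, hNx _ (hdP i), smul_zero]
    · rw [show k3Form (∑ i, k3Form v (fun j => (aP i j : ℂ)) • fun j => (dP i j : ℂ)) xbar =
          k3FormC (∑ i, k3Form v (fun j => (aP i j : ℂ)) • fun j => (dP i j : ℂ)) xbar from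
          (k3FormC_apply _ _).symm, map_sum, LinearMap.sum_apply]
      refine Finset.sum_eq_zero fun i _ => ?_
      rw [map_smul, LinearMap.smul_apply, k3FormC_apply, hNxbar _ (hdP i), smul_zero]
  have hMfx : ∃ c : ℂ, Mf x = c • x := by
    obtain ⟨c, hcx⟩ := hMx
    exact ⟨c, by rw [hMf, hPCx, sub_zero, hcx]⟩
  have hMfxbar : ∃ c : ℂ, Mf xbar = c • xbar := by
    obtain ⟨c, hcx⟩ := hMxbar
    exact ⟨c, by rw [hMf, hPCxbar, sub_zero, hcx]⟩
  have hMf11 : ∀ v : K3Index → ℂ, k3Form v x = 0 → k3Form v xbar = 0 →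
      k3Form (Mf v) x = 0 ∧ k3Form (Mf v) xbar = 0 := by
    intro v hvx hvxbar
    rw [hMf]
    refine hM11 _ ?_ ?_
    · rw [k3Form_sub_left, hvx, (hPC11 v).1, sub_zero]
    · rw [k3Form_sub_left, hvxbar, (hPC11 v).2, sub_zero]
  have hfN : ∀ n ∈ N, f n = 0 := fun n hn => by rw [hf, hPleft n hn, sub_self, map_zero]
  have hfT : ∀ u, f u ∈ T := fun u => hφT _ (hQT u)
  obtain ⟨r, s, hrs⟩ := hU f Mf hMfrat hMfx hMfxbar hMf11 hfN hfT
  -- on `T`: `φ t = r t + s ε t`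
  have hφt : ∀ t ∈ T, φ t = r • t + s • ε t := fun t ht => by
    rw [← hrs t ht, hf, hPright t ht, sub_zero]
  -- (4) the part supported on `N`: `D = (φ - r) ∘ pr_N`
  let D : (K3Index → ℚ) →ₗ[ℚ] (K3Index → ℚ) := (φ - r • LinearMap.id) ∘ₗ P
  have hD : ∀ u, D u = φ (P u) - r • P u := fun u => rfl
  have hDN : ∀ u, D u ∈ N := fun u => N.sub_mem (hφN _ (hPN u)) (N.smul_mem r (hPN u))
  have hDT : ∀ t ∈ T, D t = 0 := fun t ht => by rw [hD, hPright t ht, map_zero, smul_zero, sub_zero]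
  obtain ⟨m, a, b, ha, hb, hDsum⟩ := exists_eq_sum_rankOne hBs hBn N D hDN hDT
  refine ⟨m, a, b, r, s, ha, hb, fun u => ?_⟩
  -- `φ u = φ (P u) + φ (u - P u) = D u + r P u + r (u - P u) + s ε (u - P u)`, `ε (P u) = 0`
  have hdecomp : φ u = D u + r • u + s • ε u := by
    have hu : u = P u + (u - P u) := (add_sub_cancel (P u) u).symm
    conv_lhs => rw [hu, map_add, hφt _ (hQT u)]
    rw [hD, map_sub, hεN _ (hPN u), smul_sub, smul_sub, smul_zero, sub_zero]
    abel
  rw [hdecomp, hDsum u]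

end Summit.HodgeConjecture.HodgeConjecture.Theorems.NikulinTwinTransport
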